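import Literature.NumberTheory.Automorphic.ReciprocityGLn
import Mathlib
import HarnessLib

/-!
# Stub `stub_predictedPolyCongr` of line `Sketch` (crux stmt-Langlands-15112 `ParityBlindBianchi.ResidualBianchiDoorLevel`)

In `ℚ̄₂ = PadicAlgCl 2` with a field isomorphism `ι : ℚ̄₂ ≃ ℂ`, an odd natural number `q` and
`k : ℤ`: if `Q ∈ ℤ̄₂[X]` maps to `ι⁻¹(H)` for a monic quadratic `H = (X - β₁)(X - β₂) ∈ ℂ[X]`, then
the Harris–Lan–Taylor–Thorne prediction
`arithFrobPolyOfSatake ι q 2 {(√q)^{k-1} β₁⁻¹, (√q)^{k-1} β₂⁻¹} = (X - s ι⁻¹β₁)(X - s ι⁻¹β₂)`,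
`s = (ι⁻¹√q)^{-k}`, and `s` is a principal unit of `ℤ̄₂`: `(ι⁻¹√q)² = q ≡ 1 (mod 2)` and
`‖2‖ < 1` force `‖ι⁻¹√q - 1‖ < 1`.  As the coefficients `-ι⁻¹(β₁ + β₂)`, `ι⁻¹(β₁ β₂)` of `Q` are
integral, every coefficient of the prediction is within distance `< 1` of the corresponding
coefficient of `Q`.

* `stub_predictedPolyCongr` — the registered stub signature (pure valuation theory in `ℚ̄₂`).

Private helpers: principal units `‖x - 1‖ < 1` of an ultrametric normed field form a group
(`norm_mul_sub_one_lt`, `norm_inv_sub_one_lt`, `norm_zpow_sub_one_lt`); in residue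
characteristic `2` a square root of a principal unit is a principal unit
(`norm_sub_one_lt_of_sq`); the coefficients of `(X - s a)(X - s b)` are those of `(X - a)(X - b)`
scaled by powers of `s` (`coeff_X_sub_C_mul_X_sub_C_smul`).
-/

noncomputable section

open scoped Polynomial Valued NNReal
open Polynomial Literature.NumberTheory.Automorphic

namespace Summit.Langlands.Langlands.Cruxes.ResidualBianchiDoorLevel.Sketch

set_option linter.dupNamespace false

section Ultrametric

variable {K : Type*} [NormedField K] [IsUltrametricDist K]

/-- A principal unit `x` (`‖x - 1‖ < 1`) of an ultrametric normed field has norm `1`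
(all triangles are isosceles). [folklore] -/
private theorem norm_eq_one_of_norm_sub_one_lt {x : K} (hx : ‖x - 1‖ < 1) : ‖x‖ = 1 := by
  have h : ‖x - 1‖ ≠ ‖(1 : K)‖ := by rw [norm_one]; exact hx.ne
  have h' := IsUltrametricDist.norm_add_eq_max_of_norm_ne_norm h
  rw [sub_add_cancel, norm_one] at h'
  rw [h', max_eq_right hx.le]

/-- Principal units of an ultrametric normed field are closed under multiplication:
`x y - 1 = x (y - 1) + (x - 1)`. [folklore] -/
private theorem norm_mul_sub_one_lt {x y : K} (hx : ‖x - 1‖ < 1) (hy : ‖y - 1‖ < 1) :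
    ‖x * y - 1‖ < 1 := by
  have h : x * y - 1 = x * (y - 1) + (x - 1) := by ring
  rw [h]
  refine (IsUltrametricDist.norm_add_le_max _ _).trans_lt (max_lt ?_ hx)
  rw [norm_mul, norm_eq_one_of_norm_sub_one_lt hx, one_mul]
  exact hy

/-- Principal units of an ultrametric normed field are closed under inversion:
`x⁻¹ - 1 = x⁻¹ (1 - x)` and `‖x⁻¹‖ = 1`. [folklore] -/
private theorem norm_inv_sub_one_lt {x : K} (hx : ‖x - 1‖ < 1) : ‖x⁻¹ - 1‖ < 1 := by
  have hx1 := norm_eq_one_of_norm_sub_one_lt hx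
  have hx0 : x ≠ 0 := by
    rintro rfl
    rw [norm_zero] at hx1
    exact zero_ne_one hx1
  have h : x⁻¹ - 1 = x⁻¹ * (1 - x) := by field_simp
  rw [h, norm_mul, norm_inv, hx1, inv_one, one_mul, norm_sub_rev]
  exact hx

/-- Principal units of an ultrametric normed field are closed under natural powers. [folklore] -/
private theorem norm_pow_sub_one_lt {x : K} (hx : ‖x - 1‖ < 1) (n : ℕ) : ‖x ^ n - 1‖ < 1 := by
  induction n with
  | zero => simp
  | succ n ih => rw [pow_succ]; exact norm_mul_sub_one_lt ih hx

/-- Principal units of an ultrametric normed field are closed under integer powers. [folklore] -/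
private theorem norm_zpow_sub_one_lt {x : K} (hx : ‖x - 1‖ < 1) (n : ℤ) : ‖x ^ n - 1‖ < 1 := by
  obtain ⟨m, rfl | rfl⟩ := Int.eq_nat_or_neg n
  · rw [zpow_natCast]; exact norm_pow_sub_one_lt hx m
  · rw [zpow_neg, zpow_natCast]; exact norm_inv_sub_one_lt (norm_pow_sub_one_lt hx m)

/-- In residue characteristic `2` (`‖2‖ < 1`) a square root `x` of a principal unit is a principal
unit: `‖x‖ = 1`, so `‖x - 1‖ ≤ 1`, and `‖x - 1‖ = 1` would give `‖x + 1‖ = ‖(x - 1) + 2‖ = 1`,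
whence `‖x² - 1‖ = ‖x + 1‖ ‖x - 1‖ = 1`. [folklore] -/
private theorem norm_sub_one_lt_of_sq (h2 : ‖(2 : K)‖ < 1) {x : K} (hx : ‖x ^ 2 - 1‖ < 1) :
    ‖x - 1‖ < 1 := by
  have hx1 : ‖x‖ = 1 := by
    have h := norm_eq_one_of_norm_sub_one_lt hx
    rw [norm_pow] at h
    exact (pow_eq_one_iff_of_nonneg (norm_nonneg x) two_ne_zero).mp h
  have hle : ‖x - 1‖ ≤ 1 := by
    rw [sub_eq_add_neg]
    refine (IsUltrametricDist.norm_add_le_max x (-1)).trans ?_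
    rw [norm_neg, hx1, norm_one, max_self]
  by_contra hlt
  have heq : ‖x - 1‖ = 1 := le_antisymm hle (not_lt.mp hlt)
  have hplus : ‖x + 1‖ = 1 := by
    have hne : ‖x - 1‖ ≠ ‖(2 : K)‖ := by rw [heq]; exact h2.ne'
    have h := IsUltrametricDist.norm_add_eq_max_of_norm_ne_norm hne
    rw [show x - 1 + 2 = x + 1 by ring] at h
    rw [h, heq, max_eq_left h2.le]
  have hsq : ‖x ^ 2 - 1‖ = 1 := by
    rw [show x ^ 2 - 1 = (x + 1) * (x - 1) by ring, norm_mul, hplus, heq, one_mul]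
  rw [hsq] at hx
  exact lt_irrefl _ hx

end Ultrametric

section Quadratic

variable {R : Type*} [CommRing R]

/-- `(X - a)(X - b) = X² - (a + b) X + a b`. [folklore] -/
private theorem X_sub_C_mul_X_sub_C (a b : R) :
    (X - C a) * (X - C b) = X ^ 2 - C (a + b) * X + C (a * b) := by
  simp only [map_add, map_mul]
  ring

/-- The coefficients of the monic quadratic `X² - u X + v`: `v, -u, 1, 0, 0, …`. [folklore] -/
private theorem coeff_quadratic (u v : R) :
    (X ^ 2 - C u * X + C v).coeff 0 = v ∧ (X ^ 2 - C u * X + C v).coeff 1 = -u ∧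
      (X ^ 2 - C u * X + C v).coeff 2 = 1 ∧ ∀ i, (X ^ 2 - C u * X + C v).coeff (i + 3) = 0 := by
  refine ⟨by simp, by simp, by simp, fun i => by simp⟩

/-- The coefficients of `(X - s a)(X - s b)` are those of `(X - a)(X - b)` scaled by powers of `s`
(`a b ↦ s² a b`, `-(a + b) ↦ -s (a + b)`, `1 ↦ 1`, `0 ↦ 0`). [folklore] -/
private theorem coeff_X_sub_C_mul_X_sub_C_smul (s a b : R) (i : ℕ) :
    ∃ m : ℕ, ((X - C (s * a)) * (X - C (s * b))).coeff i =
      s ^ m * ((X - C a) * (X - C b)).coeff i := by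
  rw [X_sub_C_mul_X_sub_C, X_sub_C_mul_X_sub_C]
  obtain ⟨h0, h1, h2, h3⟩ := coeff_quadratic (s * a + s * b) (s * a * (s * b))
  obtain ⟨h0', h1', h2', h3'⟩ := coeff_quadratic (a + b) (a * b)
  match i with
  | 0 => exact ⟨2, by rw [h0, h0']; ring⟩
  | 1 => exact ⟨1, by rw [h1, h1']; ring⟩
  | 2 => exact ⟨0, by rw [h2, h2']; ring⟩
  | i + 3 => exact ⟨0, by rw [h3, h3']; ring⟩

/-- If the coefficients of `(X - a)(X - b)` have norm `≤ 1` and `s` is a principal unit of an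
ultrametric normed field, then `(X - s a)(X - s b) ≡ (X - a)(X - b)` coefficientwise modulo the
maximal ideal `{‖·‖ < 1}`. [folklore] -/
private theorem norm_coeff_sub_coeff_lt {K : Type*} [NormedField K] [IsUltrametricDist K]
    {s a b : K} (hs : ‖s - 1‖ < 1) (hint : ∀ i, ‖((X - C a) * (X - C b)).coeff i‖ ≤ 1) (i : ℕ) :
    ‖((X - C a) * (X - C b)).coeff i - ((X - C (s * a)) * (X - C (s * b))).coeff i‖ < 1 := by
  obtain ⟨m, hm⟩ := coeff_X_sub_C_mul_X_sub_C_smul s a b i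
  rw [hm, ← one_sub_mul, norm_mul, norm_sub_rev]
  exact mul_lt_one_of_nonneg_of_lt_one_left (norm_nonneg _) (norm_pow_sub_one_lt hs m) (hint i)

end Quadratic

/-- **Stub `stub_predictedPolyCongr` (the `m = 2` prediction is congruent to the Hecke polynomial).**
In `ℚ̄₂` with `ι : ℚ̄₂ ≃ ℂ`, `q` ODD, `k : ℤ`: if `Q ∈ ℤ̄₂[X]` maps to `ι⁻¹(H)` for a monic quadratic
`H = (X - β₁)(X - β₂) ∈ ℂ[X]`, then `arithFrobPolyOfSatake ι q 2 {(√q)^{k-1}β₁⁻¹, (√q)^{k-1}β₂⁻¹}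
= (X - s ι⁻¹β₁)(X - s ι⁻¹β₂)` with `s = (ι⁻¹√q)^{-k}`, and `s ≡ 1 (mod 𝔪)` because `(ι⁻¹√q)² = q ≡ 1`
and `‖2‖ < 1`; as the coefficients `-ι⁻¹(β₁+β₂)`, `ι⁻¹(β₁β₂)` of `Q` are integral, every coefficient
of the prediction is within distance `< 1` of the corresponding coefficient of `Q`.
[cite: HarrisLanTaylorThorneRMS2016, Thm. A] -/
theorem stub_predictedPolyCongr (ι : PadicAlgCl 2 ≃+* ℂ) {q : ℕ} (hq : Odd q) (k : ℤ)
    (Q : Polynomial 𝒪[PadicAlgCl 2]) (H : Polynomial ℂ) (hH : H.Monic) (hdeg : H.natDegree = 2)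
    (hQH : Q.map (𝒪[PadicAlgCl 2]).subtype = H.map (ι.symm : ℂ →+* PadicAlgCl 2)) :
    ∀ i : ℕ, ‖(Q.map (𝒪[PadicAlgCl 2]).subtype).coeff i -
      (arithFrobPolyOfSatake ι q 2
        (H.roots.map fun β => (((Real.sqrt q : ℝ) : ℂ)) ^ (k - 1) * β⁻¹)).coeff i‖ < 1 := by
  -- (1) the coefficients of `Q` are integral
  have hint : ∀ i, ‖(Q.map (𝒪[PadicAlgCl 2]).subtype).coeff i‖ ≤ 1 := by
    intro i
    rw [Polynomial.coeff_map, Subring.coe_subtype]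
    have h : ‖((Q.coeff i : 𝒪[PadicAlgCl 2]) : PadicAlgCl 2)‖₊ ≤ 1 :=
      (Valuation.mem_integer_iff _ _).mp (Q.coeff i).2
    have h' := NNReal.coe_le_coe.mpr h
    rwa [coe_nnnorm, NNReal.coe_one] at h'
  -- (2) `H = (X - β₁)(X - β₂)` over the algebraically closed field `ℂ`
  have hcard : Multiset.card H.roots = 2 := by rw [IsAlgClosed.card_roots_eq_natDegree, hdeg]
  obtain ⟨β₁, β₂, hroots⟩ := Multiset.card_eq_two.mp hcard
  have hHprod : H = (X - C β₁) * (X - C β₂) := by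
    conv_lhs => rw [← prod_multiset_X_sub_C_of_monic_of_roots_card_eq hH (hcard.trans hdeg.symm)]
    rw [hroots]
    simp
  have hP : Q.map (𝒪[PadicAlgCl 2]).subtype = (X - C (ι.symm β₁)) * (X - C (ι.symm β₂)) := by
    rw [hQH, hHprod]
    simp
  -- (3) the prediction is `(X - s ι⁻¹β₁)(X - s ι⁻¹β₂)`, `s = (ι⁻¹√q)^{-k}`
  set c : ℂ := ((Real.sqrt q : ℝ) : ℂ) with hc_def
  have hq0 : 0 < q := hq.pos
  have hc : c ≠ 0 := by
    rw [hc_def, Ne, Complex.ofReal_eq_zero]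
    exact (Real.sqrt_pos.mpr (by exact_mod_cast hq0)).ne'
  have key : ((fun a : ℂ => X - C (ι.symm (c ^ (2 - 1) * a)⁻¹)) ∘ fun β : ℂ => c ^ (k - 1) * β⁻¹) =
      fun β : ℂ => X - C (ι.symm c ^ (-k) * ι.symm β) := by
    funext β
    show X - C (ι.symm (c ^ 1 * (c ^ (k - 1) * β⁻¹))⁻¹) = X - C (ι.symm c ^ (-k) * ι.symm β)
    rw [pow_one, ← mul_assoc, zpow_sub_one₀ hc, mul_comm c, inv_mul_cancel_right₀ hc, mul_inv,
      inv_inv, ← zpow_neg, map_mul, map_zpow₀]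
  have hF : arithFrobPolyOfSatake ι q 2 (H.roots.map fun β => c ^ (k - 1) * β⁻¹) =
      (X - C (ι.symm c ^ (-k) * ι.symm β₁)) * (X - C (ι.symm c ^ (-k) * ι.symm β₂)) := by
    show ((H.roots.map fun β => c ^ (k - 1) * β⁻¹).map
      fun a : ℂ => X - C (ι.symm (c ^ (2 - 1) * a)⁻¹)).prod = _
    rw [Multiset.map_map, key, hroots]
    simp
  -- (4) `ι⁻¹√q` is a square root of `q ≡ 1 (mod 2)`, hence a principal unit, and so is `s`
  have hr2 : ι.symm c ^ 2 = (q : PadicAlgCl 2) := by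
    rw [← map_pow, hc_def, ← Complex.ofReal_pow, Real.sq_sqrt (Nat.cast_nonneg q),
      Complex.ofReal_natCast, map_natCast]
  have h2 : ‖(2 : PadicAlgCl 2)‖ < 1 := by
    rw [← map_ofNat (algebraMap ℚ_[2] (PadicAlgCl 2)) 2, norm_algebraMap']
    simpa using Padic.norm_p_lt_one (p := 2)
  have hq1 : ‖(q : PadicAlgCl 2) - 1‖ < 1 := by
    obtain ⟨t, ht⟩ := hq
    rw [ht]
    push_cast
    rw [add_sub_cancel_right, norm_mul]
    exact mul_lt_one_of_nonneg_of_lt_one_left (norm_nonneg _) h2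
      (IsUltrametricDist.norm_natCast_le_one _ t)
  have hr1 : ‖ι.symm c - 1‖ < 1 := norm_sub_one_lt_of_sq h2 (by rw [hr2]; exact hq1)
  have hs : ‖ι.symm c ^ (-k) - 1‖ < 1 := norm_zpow_sub_one_lt hr1 (-k)
  -- (5) conclude coefficientwise
  rw [hP] at hint
  intro i
  rw [hF, hP]
  exact norm_coeff_sub_coeff_lt hs hint i

end Summit.Langlands.Langlands.Cruxes.ResidualBianchiDoorLevel.Sketch

end
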